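import Mathlib
import Summits.Ventures.PercRepro.TriangleCapRowACapMain
import Summits.Ventures.PercRepro.TriangleCapRowAPieces

/-!
# PercRepro — THE ROW `r = a` OF THE STABILITY TABLE FOR EVERY `5 ≤ a ≤ 18`: on the cell `(k, a, a)`, `k ≥ 3a`, every
`K₄⁻`-free graph that is not `a`-bipartite is at least `2 (k − a − 3)` below the closed form, and the broom-`B2`
family (`K_{a+1,k−a−1}` minus a broom of `k − a − 1` pairs) attains it (p3, gen 47; part 200p)

The first cells beyond `r = a − 1`: the family `B2` no longer exists (its star would isolate a vertex), the
one-triangle family `T` sits `2k − 14` below, and the non-bipartite second best is the bipartite second best of the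
other bipartition — the broom — `2 (k − a − 3)` below, strictly less than `T` for `a ≥ 5` (at `a = 4` the two agree:
the two families of `(k, 4, 4)`, §10bz(q)). NO INDUCTION: the cap is part 200n (`cap_A_gen`), the window is
`rowA_window` (`2r = 2a ≥ a`), a vertex of degree `d ≤ a − 1` is deleted onto `(k − 1, a, d)` — the diagonal
(`d = 0`, `diag_second_order_gen`), a `B2` cell (part 200d, `1 ≤ d ≤ a − 3`), the `T` cell (part 200i, `d = a − 2`)
or the `B2` cell `r = a − 1` (part 200l, `d = a − 1`) — through `sides_A_gen` and the arithmetic of part 200o.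
`rowA_nonbip_second_best`: the value EXACTLY; `second_best_A_cell`: the second-best value of the cherry table on
`(k, a, a)` is `closed − 2 (a − 2)` (the brooms of the `a`-side). Axioms: standard.
-/

namespace PercRepro

namespace TriangleCap

namespace C047

open Finset

variable {V : Type*} [Fintype V] [DecidableEq V]

/-- **THE ROW `r = a`, `5 ≤ a ≤ 18`, `3a ≤ k`:** `K₄⁻`-free, `m + a = a (k − a)` ⇒ `a`-bipartite or
`Σ_v d(v)² + a (k − 1 − a) + 2 (k − a − 3) ≤ m k`. -/
theorem rowA_second_order_gen (D : SimpleGraph V) [DecidableRel D.Adj] (hK : K4mFree D) (a : ℕ)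
    (ha5 : 5 ≤ a) (ha18 : a ≤ 18) (hk : 3 * a ≤ Fintype.card V)
    (hm : D.edgeFinset.card + a = a * (Fintype.card V - a)) :
    (∃ A : Finset V, A.card = a ∧ BipSub D A) ∨
      ∑ v, deg D v * deg D v + a * (Fintype.card V - 1 - a) + 2 * (Fintype.card V - a - 3) ≤
        D.edgeFinset.card * Fintype.card V := by
  have hk2 : 2 * a + 2 ≤ Fintype.card V := by omega
  -- (A) a vertex at the cap
  by_cases hx : ∃ x, deg D x + a = Fintype.card V
  · obtain ⟨x, hx⟩ := hx
    exact cap_A_gen D hK a ha5 hk hm x hx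
  push Not at hx
  have hcap : ∀ v, deg D v + a ≤ Fintype.card V := fun v =>
    deg_add_le_card_of_dense D hK a (by omega) (by omega)
      (cap_arith a (Fintype.card V) D.edgeFinset.card a (by omega) (by omega)
        (below_cap_arith a (Fintype.card V) D.edgeFinset.card a (by omega) hm)) v
  have hcap' : ∀ v, deg D v + a + 1 ≤ Fintype.card V := fun v => by
    have h1 := hcap v
    have h2 := hx v
    omega
  have hcap2 : ∀ v, deg D v ≤ (Fintype.card V - a - 2) + 1 := fun v => by have := hcap' v; omega
  -- (B) every degree `≥ a`: the window
  by_cases hdeg : ∀ v, a ≤ deg D v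
  · exact Or.inr (rowA_window D a (by omega) (by omega) hm hcap' hdeg)
  push Not at hdeg
  obtain ⟨z, hz⟩ := hdeg
  -- the deletion bookkeeping: `D − z` on `(k − 1, a, d)`
  have hK' := k4mFree_del D hK z
  have hcard' := card_del z
  have hedges' := card_edges_del D z
  have hsq := sum_deg_sq_del D z
  have hT := sum_del_nbhd_le D z (Fintype.card V - a - 2) hcap2
  obtain ⟨T, hTdef⟩ : ∃ T, ∑ w : {v : V // v ≠ z}, (if D.Adj w.1 z then deg (del D z) w else 0) = T := ⟨_, rfl⟩
  obtain ⟨S', hS'def⟩ : ∃ S', ∑ w : {v : V // v ≠ z}, deg (del D z) w * deg (del D z) w = S' := ⟨_, rfl⟩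
  obtain ⟨m', hm'def⟩ : ∃ m', (del D z).edgeFinset.card = m' := ⟨_, rfl⟩
  rw [hTdef, hS'def] at hsq
  rw [hTdef] at hT
  rw [hm'def] at hedges'
  have hcardV' : Fintype.card {v : V // v ≠ z} = Fintype.card V - 1 := by omega
  have hm' : (del D z).edgeFinset.card + deg D z = a * (Fintype.card {v : V // v ≠ z} - a) := by
    rw [hm'def, hcardV']
    exact below_cell_edges a a (deg D z) (deg D z) (Fintype.card V) D.edgeFinset.card m' hk2 (by omega) hedges' hm
  have hmd : m' + deg D z + a = a * (Fintype.card V - a) := by omega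
  have hside : ∀ A' : Finset {v : V // v ≠ z}, A'.card = a → BipSub (del D z) A' →
      (∃ A : Finset V, A.card = a ∧ BipSub D A) ∨
        (∑ v, deg D v * deg D v + a * (Fintype.card V - 1 - a) + 2 * (Fintype.card V - a - 3) ≤
          D.edgeFinset.card * Fintype.card V) ∨
        (2 ≤ deg D z ∧ T + (Fintype.card V - a - 2) ≤ deg D z * (Fintype.card V - a - 2) + a) := by
    intro A' hA'card hB
    have := sides_A_gen D a (by omega) hk hm z (by omega) A' hA'card hB hm' hcap2
    rw [hTdef] at this
    exact this
  -- the four kinds of cells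
  rcases Nat.eq_zero_or_pos (deg D z) with hd0 | hdpos
  · -- `d = 0`: the diagonal `(k − 1, a, 0)`
    have hm'0 : (del D z).edgeFinset.card = a * (Fintype.card {v : V // v ≠ z} - a) := by
      have := hm'
      rw [hd0, add_zero] at this
      exact this
    rcases diag_second_order_gen (del D z) hK' a (by omega) (by omega) hm'0 with ⟨A', hA'card, hB⟩ | hgap
    · rcases hside A' hA'card hB with h | h | ⟨h2, _⟩
      · exact Or.inl h
      · exact Or.inr h
      · omega
    · right
      rw [hS'def, hm'def, hcardV'] at hgap
      rw [hd0] at hT hedges' hmd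
      rw [hsq, ← hedges', hd0]
      exact rowA_del_zero a (Fintype.card V) m' S' T ha5 hk hmd hgap hT
  · rcases Nat.lt_or_ge (deg D z + 2) a with hd3 | hd3
    · -- `1 ≤ d ≤ a − 3`: a `B2` cell
      rcases below_second_order_all (del D z) hK' a (deg D z) (by omega) ha18 (by omega) (by omega) hm'
        with ⟨A', hA'card, hB⟩ | hgap
      · rcases hside A' hA'card hB with h | h | ⟨h2, hT'⟩
        · exact Or.inl h
        · exact Or.inr h
        · right
          have hS := sum_deg_sq_le_of_bipSub (del D z) A' hB a (deg D z) hA'card hm' (by omega)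
          rw [hS'def, hm'def, hcardV'] at hS
          rw [hsq, ← hedges']
          exact rowA_mixed a (deg D z) (Fintype.card V) m' S' T ha5 h2 (by omega) hk hmd hS hT'
      · right
        rw [hS'def, hm'def, hcardV'] at hgap
        rw [hsq, ← hedges']
        exact rowA_del_B2 a (deg D z) (Fintype.card V) m' S' T ha5 hdpos (by omega) hk hmd hgap hT
    · rcases Nat.lt_or_ge (deg D z + 1) a with hd2 | hd2
      · -- `d = a − 2`: the `T` cell
        have hda : deg D z = a - 2 := by omega
        rw [hda] at hm' hT hedges' hmd
        rcases rowT_second_order_gen (del D z) hK' a (a - 2) ha5 ha18 (by omega) (by rw [hcardV']; omega) hm'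
          with ⟨A', hA'card, hB⟩ | hgap
        · rcases hside A' hA'card hB with h | h | ⟨h2, hT'⟩
          · exact Or.inl h
          · exact Or.inr h
          · right
            have hS := sum_deg_sq_le_of_bipSub (del D z) A' hB a (a - 2) hA'card hm' (by omega)
            rw [hS'def, hm'def, hcardV'] at hS
            rw [hda] at hT' h2
            rw [hsq, ← hedges', hda]
            exact rowA_mixed a (a - 2) (Fintype.card V) m' S' T ha5 h2 (by omega) hk hmd hS hT'
        · right
          rw [hS'def, hm'def, hcardV'] at hgap
          rw [hsq, ← hedges', hda]
          exact rowA_del_T a (Fintype.card V) m' S' T ha5 hk hmd hgap hT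
      · -- `d = a − 1`: the `B2` cell `r′ = a − 1`
        have hda : deg D z = a - 1 := by omega
        rw [hda] at hm' hT hedges' hmd
        rcases rowB_second_order_all (del D z) hK' a (a - 1) ha5 ha18 (by omega) (by rw [hcardV']; omega) hm'
          with ⟨A', hA'card, hB⟩ | hgap
        · rcases hside A' hA'card hB with h | h | ⟨h2, hT'⟩
          · exact Or.inl h
          · exact Or.inr h
          · right
            have hS := sum_deg_sq_le_of_bipSub (del D z) A' hB a (a - 1) hA'card hm' (by omega)
            rw [hS'def, hm'def, hcardV'] at hS
            rw [hda] at hT' h2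
            rw [hsq, ← hedges', hda]
            exact rowA_mixed a (a - 1) (Fintype.card V) m' S' T ha5 h2 (by omega) hk hmd hS hT'
        · right
          rw [hS'def, hm'def, hcardV'] at hgap
          rw [hsq, ← hedges', hda]
          exact rowA_del_B a (Fintype.card V) m' S' T ha5 hk hmd hgap hT

/-- **THE BROOM-`B2` WITNESS ON `(k, a, a)`:** `broom k (a + 1) (k − a − 1)` (`K_{a+1,k−a−1}` minus a `(k − a − 2)`-star
at `0` minus the pair `{1, a + 1}`) is `K₄⁻`-free with `a (k − a) − a` edges, is `a`-bipartite for no `A`, and has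
`Σ_v d(v)² + a (k − 1 − a) + 2 (k − a − 3) = m k` (`3 ≤ a`, `3a ≤ k`). -/
theorem rowA_witness (k a : ℕ) (ha3 : 3 ≤ a) (hk : 3 * a ≤ k) :
    K4mFree (broom k (a + 1) (k - a - 1) (by omega) (by omega)) ∧
      (broom k (a + 1) (k - a - 1) (by omega) (by omega)).edgeFinset.card + a = a * (k - a) ∧
      (¬ ∃ A : Finset (Fin k), A.card = a ∧ BipSub (broom k (a + 1) (k - a - 1) (by omega) (by omega)) A) ∧
      ∑ v, deg (broom k (a + 1) (k - a - 1) (by omega) (by omega)) v *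
          deg (broom k (a + 1) (k - a - 1) (by omega) (by omega)) v +
          a * (k - 1 - a) + 2 * (k - a - 3) =
        (broom k (a + 1) (k - a - 1) (by omega) (by omega)).edgeFinset.card * k := by
  have h1 : 1 < k := by omega
  have hak : a + 1 < k := by omega
  have hs : k - a - 1 - 1 = k - a - 2 := by omega
  have hadj := bipMinusStar_adj_one_a k (a + 1) (k - a - 1) h1 hak (by omega)
  rw [hs] at hadj
  have hE := card_edges_bipMinusStar k (a + 1) (k - a - 2) (by omega) (by omega)
  have hS := (sums_bipMinusStar k (a + 1) (k - a - 2) (by omega) (by omega)).2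
  have hE' := card_edges_delEdge (bipMinusStar k (a + 1) (k - a - 2)) hadj
  have hS' := sum_deg_sq_delEdge (bipMinusStar k (a + 1) (k - a - 2)) hadj
  have hd1 : deg (bipMinusStar k (a + 1) (k - a - 2)) ⟨1, h1⟩ = k - (a + 1) :=
    deg_bipMinusStar_small k (a + 1) (k - a - 2) (by omega) (by omega) 1 (le_refl 1) (by omega)
  have hda : deg (bipMinusStar k (a + 1) (k - a - 2)) ⟨a + 1, hak⟩ = a := by
    rw [deg_bipMinusStar k (a + 1) (k - a - 2) (by omega) (by omega)]
    have h0 : (⟨a + 1, hak⟩ : Fin k).val ≠ 0 := by simp only; omega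
    have hst : (⟨a + 1, hak⟩ : Fin k) ∈ rightStar k (a + 1) (k - a - 2) := by
      rw [rightStar, mem_filter]
      simp only [mem_univ, true_and]
      omega
    rw [if_neg h0, if_pos hst]
    omega
  unfold broom
  rw [hs]
  refine ⟨k4mFree_of_le _ _ (delEdge_le _ _ _) (k4mFree_bipMinusStar k (a + 1) (k - a - 2)), ?_, ?_, ?_⟩
  · -- the edge count
    obtain ⟨E, hEdef⟩ : ∃ E, (bipMinusStar k (a + 1) (k - a - 2)).edgeFinset.card = E := ⟨_, rfl⟩
    obtain ⟨E', hE'def⟩ : ∃ E', (delEdge (bipMinusStar k (a + 1) (k - a - 2)) ⟨1, h1⟩ ⟨a + 1, hak⟩).edgeFinset.card =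
        E' := ⟨_, rfl⟩
    rw [hEdef] at hE hE'
    rw [hE'def] at hE' ⊢
    obtain ⟨q, rfl⟩ : ∃ q, a = q + 3 := ⟨a - 3, by omega⟩
    obtain ⟨c, rfl⟩ : ∃ c, k = 3 * (q + 3) + c := ⟨k - 3 * (q + 3), by omega⟩
    have e1 : 3 * (q + 3) + c - (q + 3 + 1) = 2 * q + 5 + c := by omega
    have e2 : 3 * (q + 3) + c - (q + 3) - 2 = 2 * q + 4 + c := by omega
    have e3 : 3 * (q + 3) + c - (q + 3) = 2 * q + 6 + c := by omega
    rw [e1, e2] at hE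
    rw [e3]
    nlinarith [hE, hE']
  · -- not `a`-bipartite: the vertices `1, …, a` have degree `≥ a + 1`
    rintro ⟨A, hA, hB⟩
    have hk0 : 0 < k := by omega
    have hin : ∀ v : Fin k, 1 ≤ v.val → v.val ≤ a → v ∈ A := by
      intro v hv1 hva
      by_contra hvA
      have hle := deg_le_card_of_bipSub _ A hB v hvA
      have hdel := deg_delEdge (bipMinusStar k (a + 1) (k - a - 2)) hadj v
      have hdeg : deg (bipMinusStar k (a + 1) (k - a - 2)) v = k - (a + 1) := by
        have := deg_bipMinusStar_small k (a + 1) (k - a - 2) (by omega) (by omega) v.val hv1 (by omega)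
        convert this
      rw [hA] at hle
      rw [hdeg] at hdel
      split_ifs at hdel <;> omega
    obtain ⟨S, hSdef⟩ : ∃ S : Finset (Fin k), S = Icc ⟨1, by omega⟩ ⟨a, by omega⟩ := ⟨_, rfl⟩
    have hmemS : ∀ v : Fin k, v ∈ S ↔ 1 ≤ v.val ∧ v.val ≤ a := by
      intro v
      rw [hSdef, mem_Icc, Fin.le_def, Fin.le_def]
    have hScard : S.card = a := by
      rw [hSdef, Fin.card_Icc]
      simp only
      omega
    have hsub : S ⊆ A := fun v hv => hin v ((hmemS v).mp hv).1 ((hmemS v).mp hv).2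
    have hSA : S = A := eq_of_subset_of_card_le hsub (by rw [hA, hScard])
    have h0 : (⟨0, hk0⟩ : Fin k) ∉ A := by
      rw [← hSA, hmemS]
      simp only
      omega
    have hlast : (⟨k - 1, by omega⟩ : Fin k) ∉ A := by
      rw [← hSA, hmemS]
      simp only
      omega
    have hadj0 : (delEdge (bipMinusStar k (a + 1) (k - a - 2)) ⟨1, h1⟩ ⟨a + 1, hak⟩).Adj ⟨0, hk0⟩ ⟨k - 1, by omega⟩ := by
      rw [delEdge_adj]
      refine ⟨?_, ?_⟩
      · rw [bipMinusStar_adj]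
        simp only
        refine ⟨?_, ?_⟩
        · rw [Xor]
          omega
        · omega
      · simp only [Fin.ext_iff]
        omega
    have := hB _ _ hadj0
    tauto
  · -- the value
    rw [hd1, hda] at hS'
    obtain ⟨S, hSdef⟩ : ∃ S, ∑ v, deg (bipMinusStar k (a + 1) (k - a - 2)) v *
        deg (bipMinusStar k (a + 1) (k - a - 2)) v = S := ⟨_, rfl⟩
    obtain ⟨S', hS'def⟩ : ∃ S', ∑ v, deg (delEdge (bipMinusStar k (a + 1) (k - a - 2)) ⟨1, h1⟩ ⟨a + 1, hak⟩) v *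
        deg (delEdge (bipMinusStar k (a + 1) (k - a - 2)) ⟨1, h1⟩ ⟨a + 1, hak⟩) v = S' := ⟨_, rfl⟩
    obtain ⟨E, hEdef⟩ : ∃ E, (bipMinusStar k (a + 1) (k - a - 2)).edgeFinset.card = E := ⟨_, rfl⟩
    obtain ⟨E', hE'def⟩ : ∃ E', (delEdge (bipMinusStar k (a + 1) (k - a - 2)) ⟨1, h1⟩ ⟨a + 1, hak⟩).edgeFinset.card =
        E' := ⟨_, rfl⟩
    rw [hSdef] at hS hS'
    rw [hS'def] at hS'
    rw [hEdef] at hE hE'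
    rw [hE'def] at hE'
    rw [hS'def, hE'def]
    obtain ⟨q, rfl⟩ : ∃ q, a = q + 3 := ⟨a - 3, by omega⟩
    obtain ⟨c, rfl⟩ : ∃ c, k = 3 * (q + 3) + c := ⟨k - 3 * (q + 3), by omega⟩
    have e1 : 3 * (q + 3) + c - (q + 3 + 1) = 2 * q + 5 + c := by omega
    have e2 : 3 * (q + 3) + c - (q + 3) - 2 = 2 * q + 4 + c := by omega
    have e3 : 2 * (3 * (q + 3) + c) - (2 * q + 4 + c) - 1 = 4 * q + 13 + c := by omega
    have e4 : 3 * (q + 3) + c - 1 - (q + 3) = 2 * q + 5 + c := by omega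
    have e5 : 3 * (q + 3) + c - (q + 3) - 3 = 2 * q + 3 + c := by omega
    rw [e1, e2] at hE hS
    rw [e1] at hS'
    rw [e3] at hS
    rw [e4, e5]
    zify at hE hS hE' hS' ⊢
    linear_combination hS' - (3 * ((q : ℤ) + 3) + c) * hE' + hS - (3 * ((q : ℤ) + 3) + c) * hE

/-- **THE NON-BIPARTITE SECOND-BEST VALUE ON THE CELL `(k, a, a)`, `5 ≤ a ≤ 18`, `3a ≤ k`:** EXACTLY
`m k − a (k − 1 − a) − 2 (k − a − 3)`, attained by the broom-`B2` family. -/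
theorem rowA_nonbip_second_best (k a : ℕ) (ha5 : 5 ≤ a) (ha18 : a ≤ 18) (hk : 3 * a ≤ k) :
    (∀ (D : SimpleGraph (Fin k)) [DecidableRel D.Adj], K4mFree D → D.edgeFinset.card + a = a * (k - a) →
        (¬ ∃ A : Finset (Fin k), A.card = a ∧ BipSub D A) →
        ∑ v, deg D v * deg D v + a * (k - 1 - a) + 2 * (k - a - 3) ≤ D.edgeFinset.card * k) ∧
      ∃ (D : SimpleGraph (Fin k)) (_ : DecidableRel D.Adj), K4mFree D ∧ D.edgeFinset.card + a = a * (k - a) ∧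
        (¬ ∃ A : Finset (Fin k), A.card = a ∧ BipSub D A) ∧
        ∑ v, deg D v * deg D v + a * (k - 1 - a) + 2 * (k - a - 3) = D.edgeFinset.card * k := by
  have hcard : Fintype.card (Fin k) = k := Fintype.card_fin k
  refine ⟨?_, ?_⟩
  · intro D _ hK hm hnb
    rcases rowA_second_order_gen D hK a ha5 ha18 (by rw [hcard]; exact hk) (by rw [hcard]; exact hm) with h | h
    · exact absurd h hnb
    · rw [hcard] at h
      exact h
  · obtain ⟨hK, hE, hnb, hS⟩ := rowA_witness k a (by omega) hk
    exact ⟨_, inferInstance, hK, hE, hnb, hS⟩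

/-- **THE SECOND-BEST VALUE OF THE CHERRY TABLE ON THE CELL `(k, a, a)`, `5 ≤ a ≤ 18`, `3a ≤ k`:** `closed − 2 (a − 2)`
(the brooms of the `a`-side): the `a`-bipartite graphs are `≥ 2 (a − 2)` below unless they miss a star (then
extremal), the others `≥ 2 (k − a − 3) ≥ 2 (a − 2)` below. -/
theorem second_best_A_cell (k a : ℕ) (ha5 : 5 ≤ a) (ha18 : a ≤ 18) (hk : 3 * a ≤ k) :
    (∀ (D : SimpleGraph (Fin k)) [DecidableRel D.Adj], K4mFree D → D.edgeFinset.card + a = a * (k - a) →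
        ∑ v, deg D v * deg D v + a * (k - 1 - a) ≠ D.edgeFinset.card * k →
        ∑ v, deg D v * deg D v + a * (k - 1 - a) + 2 * (a - 2) ≤ D.edgeFinset.card * k) ∧
      ∃ (D : SimpleGraph (Fin k)) (_ : DecidableRel D.Adj), K4mFree D ∧ D.edgeFinset.card + a = a * (k - a) ∧
        ∑ v, deg D v * deg D v + a * (k - 1 - a) + 2 * (a - 2) = D.edgeFinset.card * k := by
  have hcard : Fintype.card (Fin k) = k := Fintype.card_fin k
  refine ⟨?_, ?_⟩
  · intro D _ hK hm hne
    rcases rowA_second_order_gen D hK a ha5 ha18 (by rw [hcard]; exact hk) (by rw [hcard]; exact hm)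
      with ⟨A, hAcard, hB⟩ | h
    · by_cases hstar : ∃ v, MissingStar D A v
      · obtain ⟨v, hv⟩ := hstar
        have h := closed_form_eq_of_missingStar D A hB hv a a hAcard (by rw [hcard]; exact hm) (by rw [hcard]; omega)
        rw [hcard] at h
        exact absurd h hne
      · have h := closed_form_stability_bipSub D A hB a a hAcard (by rw [hcard]; exact hm) (by rw [hcard]; omega)
          (by omega) hstar
        rw [hcard] at h
        exact h
    · rw [hcard] at h
      omega
  · obtain ⟨D, inst, A, hK, hAcard, hB, hns, hE, hS⟩ := broom_value k a a (by omega) (by omega) (by omega)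
    have hr' : a ≤ a * (k - a) := by
      have h1 : 1 ≤ k - a := by omega
      have h2 : a * 1 ≤ a * (k - a) := Nat.mul_le_mul_left a h1
      omega
    have hE' : D.edgeFinset.card + a = a * (k - a) := by rw [hE]; omega
    refine ⟨D, inst, hK, hE', ?_⟩
    rw [hE]
    exact hS

end C047

end TriangleCap

end PercRepro
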